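import Mathlib
import HarnessLib
import Summits.AtomisticToContinuum.Crystallization.Theses.FlatToriSuffice
import Summits.AtomisticToContinuum.Crystallization.Theorems.ChargedEnergyGap.Negative.BlocksBound
import Summits.AtomisticToContinuum.Crystallization.Theorems.ChargedEnergyGap.Negative.BlocksLocal
import Summits.AtomisticToContinuum.Crystallization.Theorems.ChargedEnergyGap.Negative.Periodisation

/-!
# `TwoShellDefectGap` — the DILUTION LEMMA (crux-strategist r1, 2026-08-17)

Crux `TwoShellDefectGap` (item `stmt-AtomisticToContinuum-11952`, route `FlatToriSuffice`):
for every periodic Lennard-Jones minimiser `P₀` and every `ε > 0` there is `g > 0` with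
`g · #bad_(2,ε)(P; P₀) ≤ #motif(P) · (e(P) − e(P₀))` for ALL periodic `P`.

The registered line `two-regimes-scale-two` splits it into a DILUTE regime
(`DiluteTwoShellPricing`: the inequality only for competitors whose bad FRACTION is `≤ θ₀`) and a
non-dilute qualitative regime.  **Theorem `twoShellDefectGap_of_dilute` below proves
`DiluteTwoShellPricing → TwoShellDefectGap` outright**: at zero temperature, for a potential that
is `≤ 0` beyond the hard core and has summable tails, "dilute" is not a regime.  Given any
competitor `P`, juxtapose a `K³`-block of `P` and an `(LK)³`-block of `P₀` far apart and
periodise with a huge cubic cell (`Periodisation.lean`): the cross terms are `≤ 0`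
(`V_LJ ≤ 0` on `[1, ∞)`), blocks are trial states (`Blocks.exists_block_energy_le`), deep block
points keep their `(2, ε)`-status (locality of the matching predicate + `Blocks.le_dist_of_deep`),
deep `P₀`-block points are good, so the new competitor has bad fraction `≤ θ₀` for `L` large
while its defect inequality is, up to `o(K³)`, `K³` times that of `P`.  Hence the dilute
inequality for the juxtaposition gives the inequality for `P` with the SAME constant `g`.

Consequences (see `STRATEGY-CENSUS.md`): (i) the stub `stub_diluteTwoShellPricing` of the
registered skeleton is equivalent to the whole crux (costume); (ii) every linear defect-gap
inequality at the exact level `e(P₀)` over all periodic competitors is dilution-invariant, so no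
"perturbative / dilute / near-minimal" restriction of it is a strictly weaker piece.
-/

noncomputable section

open scoped BigOperators Classical

namespace Summit.AtomisticToContinuum.Crystallization.Cruxes.TwoShellDefectGap.Dilution

open Literature.MathematicalPhysics.StatisticalMechanics
open Summit.AtomisticToContinuum.Crystallization.Theorems.ChargedEnergyGapNegative
open Summit.AtomisticToContinuum.Crystallization.Theorems.ChargedEnergyGapNegative.Blocks
open Summit.AtomisticToContinuum.Crystallization.Theses.FlatToriSuffice (TwoShellDefectGap)

local notation "E3" => EuclideanSpace ℝ (Fin 3)
local notation "PC" => Literature.MathematicalPhysics.StatisticalMechanics.PeriodicConfiguration 3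

/-! ## §1 The matching predicate and its locality -/

/-- `(2, ε)`-goodness of a point `z` with respect to the reference `P₀`, read in a point set `X`
(the two matching clauses of `TwoShellDefectGap`, with `X` for `P.points`). -/
def GoodIn (P₀ : PC) (X : Set E3) (ε : ℝ) (z : E3) : Prop :=
  ∃ p₀ ∈ P₀.motif, ∃ A : E3 ≃ₗᵢ[ℝ] E3,
    (∀ p ∈ P₀.points, dist p p₀ ≤ (2 : ℝ) → ∃ y ∈ X, dist y (z + A (p - p₀)) ≤ ε) ∧
    (∀ y ∈ X, dist y z ≤ (2 : ℝ) → ∃ p ∈ P₀.points, dist y (z + A (p - p₀)) ≤ ε)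

/-- The `(2, ε)`-bad motif points of `P` with respect to `P₀` (the set counted in the crux). -/
def badSet (P₀ P : PC) (ε : ℝ) : Set E3 := {x | x ∈ P.motif ∧ ¬ GoodIn P₀ P.points ε x}

/-- The registered stub's statement `DiluteTwoShellPricing` (verbatim, with `GoodIn`/`badSet`
unfolded it is the signature registered on item 11952 by `two_regimes_scale_two.lean`):
DILUTE REGIME — the linear gap only for competitors with bad fraction `≤ θ₀`. -/
def DiluteTwoShellPricing : Prop :=
  ∀ P₀ : PC, IsLeast (Set.range fun Q : PC => Q.energyPerParticle lennardJones)
      (P₀.energyPerParticle lennardJones) → ∀ η : ℝ, 0 < η → ∃ θ₀ g : ℝ, 0 < θ₀ ∧ 0 < g ∧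
    ∀ P : PC, ((badSet P₀ P η).ncard : ℝ) ≤ θ₀ * P.motif.card →
      g * ((badSet P₀ P η).ncard : ℝ) ≤
        (P.motif.card : ℝ) * (P.energyPerParticle lennardJones - P₀.energyPerParticle lennardJones)

/-- Sanity: the registered stub statement, written exactly as in
`Cruxes/TorusDefectGap/Lines/two_regimes_scale_two.lean`, is `DiluteTwoShellPricing` by `Iff.rfl`. -/
example : DiluteTwoShellPricing ↔
    (∀ P₀ : PC, IsLeast (Set.range fun Q : PC => Q.energyPerParticle lennardJones)
      (P₀.energyPerParticle lennardJones) → ∀ η : ℝ, 0 < η → ∃ θ₀ g : ℝ, 0 < θ₀ ∧ 0 < g ∧ ∀ P : PC,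
    ({x : E3 | x ∈ P.motif ∧ ¬ (∃ p₀ ∈ P₀.motif, ∃ A : E3 ≃ₗᵢ[ℝ] E3,
      (∀ p ∈ P₀.points, dist p p₀ ≤ (2 : ℝ) → ∃ y ∈ P.points, dist y (x + A (p - p₀)) ≤ η) ∧
      (∀ y ∈ P.points, dist y x ≤ (2 : ℝ) → ∃ p ∈ P₀.points, dist y (x + A (p - p₀)) ≤ η))}.ncard : ℝ)
        ≤ θ₀ * P.motif.card →
    g * ({x : E3 | x ∈ P.motif ∧ ¬ (∃ p₀ ∈ P₀.motif, ∃ A : E3 ≃ₗᵢ[ℝ] E3,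
      (∀ p ∈ P₀.points, dist p p₀ ≤ (2 : ℝ) → ∃ y ∈ P.points, dist y (x + A (p - p₀)) ≤ η) ∧
      (∀ y ∈ P.points, dist y x ≤ (2 : ℝ) → ∃ p ∈ P₀.points, dist y (x + A (p - p₀)) ≤ η))}.ncard : ℝ)
      ≤ (P.motif.card : ℝ) *
        (P.energyPerParticle lennardJones - P₀.energyPerParticle lennardJones)) :=
  Iff.rfl

/-- Sanity: the crux is the same inequality for all competitors. -/
example : TwoShellDefectGap ↔
    ∀ P₀ : PC, IsLeast (Set.range fun Q : PC => Q.energyPerParticle lennardJones)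
      (P₀.energyPerParticle lennardJones) → ∀ ε : ℝ, 0 < ε → ∃ g : ℝ, 0 < g ∧
    ∀ P : PC, g * ((badSet P₀ P ε).ncard : ℝ) ≤
        (P.motif.card : ℝ) * (P.energyPerParticle lennardJones - P₀.energyPerParticle lennardJones) :=
  Iff.rfl

/-- **Locality of goodness**: the status of `z` only depends on the points within `2 + ε` of `z`. -/
theorem goodIn_congr {P₀ : PC} {X Y : Set E3} {ε : ℝ} (hε : 0 ≤ ε) {z : E3}
    (h : ∀ y, dist y z ≤ 2 + ε → (y ∈ X ↔ y ∈ Y)) : GoodIn P₀ X ε z ↔ GoodIn P₀ Y ε z := by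
  -- a symmetric statement: prove one direction for arbitrary `X, Y`
  suffices key : ∀ X Y : Set E3, (∀ y, dist y z ≤ 2 + ε → (y ∈ X ↔ y ∈ Y)) →
      GoodIn P₀ X ε z → GoodIn P₀ Y ε z from
    ⟨key X Y h, key Y X fun y hy => (h y hy).symm⟩
  intro X Y h hg
  obtain ⟨p₀, hp₀, A, h1, h2⟩ := hg
  refine ⟨p₀, hp₀, A, fun p hp hpd => ?_, fun y hy hyd => ?_⟩
  · obtain ⟨y, hyX, hyd⟩ := h1 p hp hpd
    refine ⟨y, (h y ?_).1 hyX, hyd⟩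
    have hA : ‖A (p - p₀)‖ ≤ 2 := by
      rw [LinearIsometryEquiv.norm_map, ← dist_eq_norm]; exact hpd
    calc dist y z ≤ dist y (z + A (p - p₀)) + dist (z + A (p - p₀)) z := dist_triangle _ _ _
      _ ≤ ε + 2 := by
          gcongr
          rw [dist_eq_norm, add_sub_cancel_left]; exact hA
      _ = 2 + ε := add_comm _ _
  · have hyX : y ∈ X := (h y (by linarith)).2 hy
    exact h2 y hyX hyd

/-- **Translation covariance**: translating the point set and the point together. -/
theorem goodIn_add_iff {P₀ : PC} {X : Set E3} {ε : ℝ} (t z : E3) :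
    GoodIn P₀ ((fun x => x + t) '' X) ε (z + t) ↔ GoodIn P₀ X ε z := by
  constructor
  · rintro ⟨p₀, hp₀, A, h1, h2⟩
    refine ⟨p₀, hp₀, A, fun p hp hpd => ?_, fun y hy hyd => ?_⟩
    · obtain ⟨y, ⟨x, hx, rfl⟩, hyd⟩ := h1 p hp hpd
      refine ⟨x, hx, ?_⟩
      have : dist (x + t) (z + t + A (p - p₀)) = dist x (z + A (p - p₀)) := by
        rw [show z + t + A (p - p₀) = (z + A (p - p₀)) + t by abel, dist_add_right]
      rwa [this] at hyd
    · obtain ⟨p, hp, hpd⟩ := h2 (y + t) ⟨y, hy, rfl⟩ (by rwa [dist_add_right])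
      refine ⟨p, hp, ?_⟩
      rwa [show z + t + A (p - p₀) = (z + A (p - p₀)) + t by abel, dist_add_right] at hpd
  · rintro ⟨p₀, hp₀, A, h1, h2⟩
    refine ⟨p₀, hp₀, A, fun p hp hpd => ?_, fun y hy hyd => ?_⟩
    · obtain ⟨x, hx, hxd⟩ := h1 p hp hpd
      refine ⟨x + t, ⟨x, hx, rfl⟩, ?_⟩
      rwa [show z + t + A (p - p₀) = (z + A (p - p₀)) + t by abel, dist_add_right]
    · obtain ⟨x, hx, rfl⟩ := hy
      rw [dist_add_right] at hyd
      obtain ⟨p, hp, hpd⟩ := h2 x hx hyd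
      refine ⟨p, hp, ?_⟩
      rwa [show z + t + A (p - p₀) = (z + A (p - p₀)) + t by abel, dist_add_right]

/-- **Lattice invariance**: in a periodic `P`, goodness is invariant under the periods. -/
theorem goodIn_points_add_iff {P₀ : PC} (P : PC) {ε : ℝ} {g : E3} (hg : g ∈ P.lattice) (z : E3) :
    GoodIn P₀ P.points ε (z + g) ↔ GoodIn P₀ P.points ε z := by
  have hset : (fun x => x + g) '' P.points = P.points := by
    ext y
    constructor
    · rintro ⟨x, hx, rfl⟩; exact P.add_mem_points hx hg
    · intro hy
      refine ⟨y - g, ?_, sub_add_cancel y g⟩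
      have := P.add_mem_points hy (P.lattice.neg_mem hg)
      simpa [sub_eq_add_neg] using this
  have := goodIn_add_iff (P₀ := P₀) (X := P.points) (ε := ε) g z
  rwa [hset] at this

/-- **Every point of `P₀` is good in `P₀` itself** (reference site = its motif representative,
`A = 1`). -/
theorem goodIn_self (P₀ : PC) {ε : ℝ} (hε : 0 ≤ ε) {z : E3} (hz : z ∈ P₀.points) :
    GoodIn P₀ P₀.points ε z := by
  obtain ⟨m, hm, g, hg, rfl⟩ := hz
  rw [goodIn_points_add_iff P₀ hg]
  refine ⟨m, hm, LinearIsometryEquiv.refl ℝ E3, fun p hp _ => ⟨p, hp, ?_⟩, fun y hy _ => ⟨y, hy, ?_⟩⟩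
  · simp [hε]
  · simp [hε]


/-! ## §2 Juxtaposing a block of `P` and a block of `P₀`, far apart -/

section Jux

variable (P P₀ : PC) (K M : ℕ) (ε : ℝ)

/-- Index type of the juxtaposition: a block index of `P` or a block index of `P₀`. -/
abbrev JIdx : Type := BIdx P K ⊕ BIdx P₀ M

/-- Size of the `P`-block. -/
def D₁ : ℝ := Dsum (blockConfig P K)

/-- Size of the `P₀`-block. -/
def D₂ : ℝ := Dsum (blockConfig P₀ M)

/-- The translation applied to the `P₀`-block: far along `e₀`. -/
def shift : E3 := (D₁ P K + D₂ P₀ M + 3 + ε) • e0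

/-- The juxtaposed configuration, indexed by the sum type. -/
def juxS : JIdx P P₀ K M → E3 :=
  Sum.elim (bpt P K) (fun v => bpt P₀ M v + shift P P₀ K M ε)

/-- The juxtaposed configuration, re-indexed by `Fin`. -/
def jux : Fin (Fintype.card (JIdx P P₀ K M)) → E3 :=
  juxS P P₀ K M ε ∘ (Fintype.equivFin (JIdx P P₀ K M)).symm

@[simp] theorem juxS_inl (u : BIdx P K) : juxS P P₀ K M ε (Sum.inl u) = bpt P K u := rfl

@[simp] theorem juxS_inr (v : BIdx P₀ M) :
    juxS P P₀ K M ε (Sum.inr v) = bpt P₀ M v + shift P P₀ K M ε := rfl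

theorem jux_apply (a : Fin (Fintype.card (JIdx P P₀ K M))) :
    jux P P₀ K M ε a = juxS P P₀ K M ε ((Fintype.equivFin (JIdx P P₀ K M)).symm a) := rfl

theorem jux_equivFin (p : JIdx P P₀ K M) :
    jux P P₀ K M ε (Fintype.equivFin (JIdx P P₀ K M) p) = juxS P P₀ K M ε p := by
  simp [jux_apply]

/-- Block points of `P` have norm `≤ D₁`. -/
theorem norm_bpt_le_D₁ (u : BIdx P K) : ‖bpt P K u‖ ≤ D₁ P K := by
  have h := norm_le_Dsum (blockConfig P K) (Fintype.equivFin (BIdx P K) u)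
  rw [blockConfig_apply, Equiv.symm_apply_apply] at h
  exact h

/-- Block points of `P₀` have norm `≤ D₂`. -/
theorem norm_bpt_le_D₂ (v : BIdx P₀ M) : ‖bpt P₀ M v‖ ≤ D₂ P₀ M := by
  have h := norm_le_Dsum (blockConfig P₀ M) (Fintype.equivFin (BIdx P₀ M) v)
  rw [blockConfig_apply, Equiv.symm_apply_apply] at h
  exact h

theorem D₁_nonneg : 0 ≤ D₁ P K := Dsum_nonneg _

theorem D₂_nonneg : 0 ≤ D₂ P₀ M := Dsum_nonneg _

variable {ε}

/-- The norm of the shift. -/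
theorem norm_shift (hε : 0 ≤ ε) : ‖shift P P₀ K M ε‖ = D₁ P K + D₂ P₀ M + 3 + ε := by
  have h0 : 0 ≤ D₁ P K + D₂ P₀ M + 3 + ε := by
    linarith [D₁_nonneg P K, D₂_nonneg P₀ M]
  rw [shift, norm_smul, norm_e0, mul_one, Real.norm_of_nonneg h0]

/-- **The two blocks are far apart**: cross distances are `≥ 3 + ε`. -/
theorem le_dist_cross (hε : 0 ≤ ε) (u : BIdx P K) (v : BIdx P₀ M) :
    3 + ε ≤ dist (bpt P K u) (bpt P₀ M v + shift P P₀ K M ε) := by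
  have h1 := norm_bpt_le_D₁ P K u
  have h2 := norm_bpt_le_D₂ P₀ M v
  have hs := norm_shift P P₀ K M hε
  rw [dist_eq_norm]
  have : ‖shift P P₀ K M ε‖ - ‖bpt P K u - bpt P₀ M v‖ ≤
      ‖bpt P K u - (bpt P₀ M v + shift P P₀ K M ε)‖ := by
    rw [show bpt P K u - (bpt P₀ M v + shift P P₀ K M ε) =
        (bpt P K u - bpt P₀ M v) - shift P P₀ K M ε by abel, ← norm_neg (_ - shift P P₀ K M ε),
      neg_sub]
    exact norm_sub_norm_le _ _
  have h3 : ‖bpt P K u - bpt P₀ M v‖ ≤ D₁ P K + D₂ P₀ M :=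
    (norm_sub_le _ _).trans (add_le_add h1 h2)
  linarith

/-- Hence the juxtaposed configuration is injective. -/
theorem juxS_injective (hε : 0 ≤ ε) : Function.Injective (juxS P P₀ K M ε) := by
  rintro (u | v) (u' | v') h
  · simp only [juxS_inl] at h
    exact congrArg Sum.inl (bpt_injective P K h)
  · simp only [juxS_inl, juxS_inr] at h
    have := le_dist_cross P P₀ K M hε u v'
    rw [h, dist_self] at this
    linarith
  · simp only [juxS_inl, juxS_inr] at h
    have := le_dist_cross P P₀ K M hε u' v
    rw [← h, dist_self] at this
    linarith
  · simp only [juxS_inr] at h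
    exact congrArg Sum.inr (bpt_injective P₀ M (add_right_cancel h))

theorem jux_injective (hε : 0 ≤ ε) : Function.Injective (jux P P₀ K M ε) :=
  (juxS_injective P P₀ K M hε).comp (Fintype.equivFin (JIdx P P₀ K M)).symm.injective

/-- The juxtaposition has `#F·K³ + #F₀·M³` points. -/
theorem card_JIdx : Fintype.card (JIdx P P₀ K M) = P.motif.card * K ^ 3 + P₀.motif.card * M ^ 3 := by
  rw [Fintype.card_sum, card_BIdx, card_BIdx]

variable (ε)

/-- **Energy of the juxtaposition**: the cross terms are `≤ 0` (`V_LJ ≤ 0` on `[1, ∞)`), so the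
energy is at most the sum of the two block energies. -/
theorem interactionEnergy_jux_le (hε : 0 ≤ ε) :
    interactionEnergy lennardJones (jux P P₀ K M ε) ≤
      interactionEnergy lennardJones (blockConfig P K) +
        interactionEnergy lennardJones (blockConfig P₀ M) := by
  have h2 := two_mul_interactionEnergy_eq_sum_sum lennardJones lennardJones_zero (jux P P₀ K M ε)
  have hre : ∑ a, ∑ b, lennardJones (dist (jux P P₀ K M ε a) (jux P P₀ K M ε b)) =
      ∑ p : JIdx P P₀ K M, ∑ q : JIdx P P₀ K M,
        lennardJones (dist (juxS P P₀ K M ε p) (juxS P P₀ K M ε q)) := by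
    simp only [jux_apply]
    exact ((Fintype.equivFin (JIdx P P₀ K M)).symm.sum_comp (fun p => ∑ b,
      lennardJones (dist (juxS P P₀ K M ε p)
        (juxS P P₀ K M ε ((Fintype.equivFin (JIdx P P₀ K M)).symm b))))).trans
      (Finset.sum_congr rfl fun p _ => (Fintype.equivFin (JIdx P P₀ K M)).symm.sum_comp
        (fun q => lennardJones (dist (juxS P P₀ K M ε p) (juxS P P₀ K M ε q))))
  have hcross1 : ∀ (u : BIdx P K) (v : BIdx P₀ M),
      lennardJones (dist (bpt P K u) (bpt P₀ M v + shift P P₀ K M ε)) ≤ 0 := fun u v =>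
    lennardJones_nonpos (by linarith [le_dist_cross P P₀ K M hε u v])
  have hcross2 : ∀ (u : BIdx P K) (v : BIdx P₀ M),
      lennardJones (dist (bpt P₀ M v + shift P P₀ K M ε) (bpt P K u)) ≤ 0 := fun u v => by
    rw [dist_comm]; exact hcross1 u v
  have hsplit : ∑ p : JIdx P P₀ K M, ∑ q : JIdx P P₀ K M,
        lennardJones (dist (juxS P P₀ K M ε p) (juxS P P₀ K M ε q)) ≤
      (∑ u : BIdx P K, ∑ u' : BIdx P K, lennardJones (dist (bpt P K u) (bpt P K u'))) +
      (∑ v : BIdx P₀ M, ∑ v' : BIdx P₀ M, lennardJones (dist (bpt P₀ M v) (bpt P₀ M v'))) := by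
    rw [Fintype.sum_sum_type]
    simp only [Fintype.sum_sum_type, juxS_inl, juxS_inr, dist_add_right]
    have hA : ∑ u : BIdx P K, ∑ v : BIdx P₀ M,
        lennardJones (dist (bpt P K u) (bpt P₀ M v + shift P P₀ K M ε)) ≤ 0 :=
      Finset.sum_nonpos fun u _ => Finset.sum_nonpos fun v _ => hcross1 u v
    have hB : ∑ v : BIdx P₀ M, ∑ u : BIdx P K,
        lennardJones (dist (bpt P₀ M v + shift P P₀ K M ε) (bpt P K u)) ≤ 0 :=
      Finset.sum_nonpos fun v _ => Finset.sum_nonpos fun u _ => hcross2 u v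
    rw [Finset.sum_add_distrib, Finset.sum_add_distrib]
    linarith
  have hP := two_mul_energy_blockConfig P K
  have hP₀ := two_mul_energy_blockConfig P₀ M
  rw [hre] at h2
  linarith

/-! ### Periodising the juxtaposition with a huge cubic cell -/

variable {ε}

/-- The juxtaposition is non-empty as soon as `K ≥ 1`. -/
theorem card_JIdx_pos (hK : 0 < K) : 0 < Fintype.card (JIdx P P₀ K M) := by
  rw [card_JIdx]
  have : 0 < P.motif.card * K ^ 3 := Nat.mul_pos P.motif_nonempty.card_pos (pow_pos hK 3)
  omega

/-- The period used: `period + 1 + ε`, so that foreign points are `≥ 3 + ε` away. -/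
def cell (hε : 0 ≤ ε) : ℝˣ :=
  Units.mk0 (period (jux P P₀ K M ε) + 1 + ε) (by have := period_pos (jux P P₀ K M ε); positivity)

theorem val_cell (hε : 0 ≤ ε) : (cell P P₀ K M hε : ℝ) = period (jux P P₀ K M ε) + 1 + ε := rfl

theorem period_le_cell (hε : 0 ≤ ε) : period (jux P P₀ K M ε) ≤ (cell P P₀ K M hε : ℝ) := by
  rw [val_cell]; linarith

/-- **The diluted competitor**: the periodisation of the juxtaposition. -/
def Qj (hε : 0 ≤ ε) (hK : 0 < K) : PC :=
  periodise (jux P P₀ K M ε) (cell P P₀ K M hε) (period_le_cell P P₀ K M hε) (card_JIdx_pos P P₀ K M hK)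

theorem motif_Qj (hε : 0 ≤ ε) (hK : 0 < K) :
    (Qj P P₀ K M hε hK).motif = Finset.univ.image (jux P P₀ K M ε) :=
  motif_periodise _ _ _ _

theorem card_motif_Qj (hε : 0 ≤ ε) (hK : 0 < K) :
    (Qj P P₀ K M hε hK).motif.card = P.motif.card * K ^ 3 + P₀.motif.card * M ^ 3 := by
  rw [motif_Qj, Finset.card_image_of_injective _ (jux_injective P P₀ K M hε), Finset.card_univ,
    Fintype.card_fin, card_JIdx]

/-- Every point of the juxtaposition is a motif point of `Qj`, hence a point of `Qj`. -/
theorem juxS_mem_points (hε : 0 ≤ ε) (hK : 0 < K) (p : JIdx P P₀ K M) :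
    juxS P P₀ K M ε p ∈ (Qj P P₀ K M hε hK).points := by
  refine (Qj P P₀ K M hε hK).mem_points_of_mem_motif ?_
  rw [motif_Qj, ← jux_equivFin]
  exact Finset.mem_image_of_mem _ (Finset.mem_univ _)

/-- **Energy per particle of the diluted competitor.** -/
theorem energyPerParticle_Qj_le (hε : 0 ≤ ε) (hK : 0 < K) :
    ((P.motif.card * K ^ 3 + P₀.motif.card * M ^ 3 : ℕ) : ℝ) *
        (Qj P P₀ K M hε hK).energyPerParticle lennardJones ≤
      interactionEnergy lennardJones (blockConfig P K) +
        interactionEnergy lennardJones (blockConfig P₀ M) := by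
  have h1 := energyPerParticle_periodise_le (jux_injective P P₀ K M hε) (cell P P₀ K M hε)
    (period_le_cell P P₀ K M hε) (card_JIdx_pos P P₀ K M hK)
  have h2 := interactionEnergy_jux_le P P₀ K M ε hε
  have hN : (0 : ℝ) < Fintype.card (JIdx P P₀ K M) := by exact_mod_cast card_JIdx_pos P P₀ K M hK
  rw [← card_JIdx]
  change (Fintype.card (JIdx P P₀ K M) : ℝ) * (Qj P P₀ K M hε hK).energyPerParticle lennardJones ≤ _
  rw [le_div_iff₀ hN] at h1
  unfold Qj
  linarith

/-- **Points of `Qj` near a point of the juxtaposition are points of the juxtaposition.** -/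
theorem exists_eq_juxS_of_dist_le (hε : 0 ≤ ε) (hK : 0 < K) (p : JIdx P P₀ K M) {y : E3}
    (hy : y ∈ (Qj P P₀ K M hε hK).points) (hd : dist y (juxS P P₀ K M ε p) ≤ 2 + ε) :
    ∃ q : JIdx P P₀ K M, y = juxS P P₀ K M ε q := by
  by_contra hne
  push Not at hne
  have hfar : ∀ j, y ≠ jux P P₀ K M ε j := fun j => by rw [jux_apply]; exact hne _
  have h := sub_le_dist_of_mem_points (jux P P₀ K M ε) (cell P P₀ K M hε)
    (period_le_cell P P₀ K M hε) (card_JIdx_pos P P₀ K M hK)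
    (Fintype.equivFin (JIdx P P₀ K M) p) (by unfold Qj at hy; exact hy) hfar
  rw [jux_equivFin, val_cell, dist_comm] at h
  unfold period at h
  linarith

/-- **Near a deep block point of `P`, the points of `Qj` are exactly the points of `P`.** -/
theorem mem_points_Qj_iff_left (hε : 0 ≤ ε) (hK : 0 < K) {u : BIdx P K}
    (hdeep : IsDeep K (depth P (3 + ε)) u.2) {y : E3} (hd : dist y (bpt P K u) ≤ 2 + ε) :
    y ∈ (Qj P P₀ K M hε hK).points ↔ y ∈ P.points := by
  constructor
  · intro hy
    obtain ⟨q, rfl⟩ := exists_eq_juxS_of_dist_le P P₀ K M hε hK (Sum.inl u) hy (by simpa using hd)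
    rcases q with u' | v
    · exact bpt_mem P K u'
    · exfalso
      have := le_dist_cross P P₀ K M hε u v
      rw [juxS_inr, dist_comm] at hd
      linarith
  · intro hy
    by_cases hyu : y = bpt P K u
    · rw [hyu]; exact juxS_mem_points P P₀ K M hε hK (Sum.inl u)
    · have hne : (⟨y, hy⟩ : P.points) ≠ toP P K u := fun h => hyu (congrArg Subtype.val h)
      obtain ⟨v, -, hv⟩ := exists_eq_toP_of_dist_lt P K hdeep ⟨y, hy⟩ hne
        (by rw [dist_comm]; simp only; linarith)
      have : y = bpt P K v := by have := congrArg Subtype.val hv; simpa using this.symm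
      rw [this]; exact juxS_mem_points P P₀ K M hε hK (Sum.inl v)

/-- **Near a deep (translated) block point of `P₀`, the points of `Qj` are exactly the translated
points of `P₀`.** -/
theorem mem_points_Qj_iff_right (hε : 0 ≤ ε) (hK : 0 < K) {v : BIdx P₀ M}
    (hdeep : IsDeep M (depth P₀ (3 + ε)) v.2) {y : E3}
    (hd : dist y (bpt P₀ M v + shift P P₀ K M ε) ≤ 2 + ε) :
    y ∈ (Qj P P₀ K M hε hK).points ↔ y ∈ (fun x => x + shift P P₀ K M ε) '' P₀.points := by
  constructor
  · intro hy
    obtain ⟨q, rfl⟩ := exists_eq_juxS_of_dist_le P P₀ K M hε hK (Sum.inr v) hy (by simpa using hd)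
    rcases q with u | v'
    · exfalso
      have := le_dist_cross P P₀ K M hε u v
      rw [juxS_inl] at hd
      linarith
    · exact ⟨bpt P₀ M v', bpt_mem P₀ M v', rfl⟩
  · rintro ⟨x, hx, rfl⟩
    rw [dist_add_right] at hd
    by_cases hxv : x = bpt P₀ M v
    · rw [hxv]; exact juxS_mem_points P P₀ K M hε hK (Sum.inr v)
    · have hne : (⟨x, hx⟩ : P₀.points) ≠ toP P₀ M v := fun h => hxv (congrArg Subtype.val h)
      obtain ⟨v', -, hv'⟩ := exists_eq_toP_of_dist_lt P₀ M hdeep ⟨x, hx⟩ hne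
        (by rw [dist_comm]; simp only; linarith)
      have : x = bpt P₀ M v' := by have := congrArg Subtype.val hv'; simpa using this.symm
      rw [this]; exact juxS_mem_points P P₀ K M hε hK (Sum.inr v')

/-- **Deep block points of `P` keep their `(2, ε)`-status in `Qj`.** -/
theorem goodIn_Qj_left_iff (hε : 0 ≤ ε) (hK : 0 < K) {u : BIdx P K}
    (hdeep : IsDeep K (depth P (3 + ε)) u.2) :
    GoodIn P₀ (Qj P P₀ K M hε hK).points ε (bpt P K u) ↔ GoodIn P₀ P.points ε (u.1 : E3) := by
  rw [goodIn_congr hε fun y hy => mem_points_Qj_iff_left P P₀ K M hε hK hdeep hy]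
  exact goodIn_points_add_iff P (latVec_mem P _) _

/-- **Deep block points of `P₀` are good in `Qj`.** -/
theorem goodIn_Qj_right (hε : 0 ≤ ε) (hK : 0 < K) {v : BIdx P₀ M}
    (hdeep : IsDeep M (depth P₀ (3 + ε)) v.2) :
    GoodIn P₀ (Qj P P₀ K M hε hK).points ε (bpt P₀ M v + shift P P₀ K M ε) := by
  rw [goodIn_congr hε fun y hy => mem_points_Qj_iff_right P P₀ K M hε hK hdeep hy, goodIn_add_iff]
  exact goodIn_self P₀ hε (bpt_mem P₀ M v)

end Jux


/-! ## §3 Counting bad points -/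

section Count

variable (P₀ P : PC) (ε : ℝ)

/-- The bad set is a subset of the motif. -/
theorem badSet_subset_motif : badSet P₀ P ε ⊆ (P.motif : Set E3) := fun _ hx => hx.1

/-- `#bad ≤ #motif`. -/
theorem ncard_badSet_le : ((badSet P₀ P ε).ncard : ℝ) ≤ P.motif.card := by
  have h := Set.ncard_le_ncard (badSet_subset_motif P₀ P ε) (Finset.finite_toSet _)
  rw [Set.ncard_coe_finset] at h
  exact_mod_cast h

/-- The bad motif points, as a finset over the motif subtype. -/
def badIdx : Finset P.motif :=
  Finset.univ.filter fun m : P.motif => ¬ GoodIn P₀ P.points ε (m : E3)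

/-- Its cardinality is the bad count of the crux. -/
theorem card_badIdx : ((badIdx P₀ P ε).card : ℝ) = (badSet P₀ P ε).ncard := by
  have h1 : badSet P₀ P ε = ↑(P.motif.filter fun x => ¬ GoodIn P₀ P.points ε x) := by
    ext x; simp [badSet]
  rw [h1, Set.ncard_coe_finset]
  unfold badIdx
  rw [Finset.univ_eq_attach, Finset.filter_attach (fun x => ¬ GoodIn P₀ P.points ε x) P.motif,
    Finset.card_map, Finset.card_attach]

variable (K : ℕ) (d : ℕ)

/-- The `d`-deep lattice coordinates of a `K`-block. -/
def deepIdx : Finset (Fin 3 → Fin K) := Finset.univ.filter fun k => IsDeep K d k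

/-- **Most coordinates are deep**: `#deep ≥ K³ − 6dK²`. -/
theorem card_deepIdx_ge : (K : ℝ) ^ 3 - 6 * d * (K : ℝ) ^ 2 ≤ ((deepIdx K d).card : ℝ) := by
  have h1 := Finset.card_filter_add_card_filter_not
    (s := (Finset.univ : Finset (Fin 3 → Fin K))) (fun k => IsDeep K d k)
  have h2 : (Finset.univ : Finset (Fin 3 → Fin K)).card = K ^ 3 := by
    rw [Finset.card_univ, Fintype.card_fun, Fintype.card_fin, Fintype.card_fin]
  have h3 := card_not_deep_le K d
  have h4 : ((deepIdx K d).card : ℝ) + ((Finset.univ.filter fun k : Fin 3 → Fin K =>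
      ¬ IsDeep K d k).card : ℝ) = (K : ℝ) ^ 3 := by
    unfold deepIdx; exact_mod_cast (h2 ▸ h1)
  have h5 : ((Finset.univ.filter fun k : Fin 3 → Fin K => ¬ IsDeep K d k).card : ℝ) ≤
      6 * d * (K : ℝ) ^ 2 := by exact_mod_cast h3
  linarith

/-- The non-deep count is at most `6dK²` (real form). -/
theorem card_not_deep_le_real :
    ((Finset.univ.filter fun k : Fin 3 → Fin K => ¬ IsDeep K d k).card : ℝ) ≤ 6 * d * (K : ℝ) ^ 2 := by
  exact_mod_cast card_not_deep_le K d

end Count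

section CountQj

variable (P P₀ : PC) (K M : ℕ) {ε : ℝ}

/-- **Lower bound**: every deep copy of a bad motif point of `P` is a bad motif point of `Qj`, so
`#bad(Qj) ≥ #bad(P) · #deep ≥ #bad(P) · (K³ − 6 d₁ K²)`, `d₁ = depth_P(3 + ε)`. -/
theorem ncard_badSet_Qj_ge (hε : 0 ≤ ε) (hK : 0 < K) :
    ((badSet P₀ P ε).ncard : ℝ) * ((K : ℝ) ^ 3 - 6 * (depth P (3 + ε)) * (K : ℝ) ^ 2) ≤
      ((badSet P₀ (Qj P P₀ K M hε hK) ε).ncard : ℝ) := by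
  classical
  set d₁ := depth P (3 + ε) with hd₁
  set S : Finset (BIdx P K) :=
    Finset.univ.filter fun u : BIdx P K => ¬ GoodIn P₀ P.points ε (u.1 : E3) ∧ IsDeep K d₁ u.2
    with hS
  -- `S` is a product
  have hScard : S.card = (badIdx P₀ P ε).card * (deepIdx K d₁).card := by
    have : S = badIdx P₀ P ε ×ˢ deepIdx K d₁ := by
      rw [hS, badIdx, deepIdx, ← Finset.filter_product, Finset.univ_product_univ]
    rw [this, Finset.card_product]
  -- its image consists of bad motif points of `Qj`
  have hsub : ((S.image (bpt P K) : Finset E3) : Set E3) ⊆ badSet P₀ (Qj P P₀ K M hε hK) ε := by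
    intro x hx
    rw [Finset.coe_image] at hx
    obtain ⟨u, hu, rfl⟩ := hx
    rw [Finset.mem_coe, hS, Finset.mem_filter] at hu
    obtain ⟨-, hbad, hdeep⟩ := hu
    refine ⟨?_, ?_⟩
    · rw [motif_Qj, ← juxS_inl P P₀ K M ε u, ← jux_equivFin]
      exact Finset.mem_image_of_mem _ (Finset.mem_univ _)
    · rwa [goodIn_Qj_left_iff P P₀ K M hε hK hdeep]
  have hfin : (badSet P₀ (Qj P P₀ K M hε hK) ε).Finite :=
    (Finset.finite_toSet _).subset (badSet_subset_motif P₀ _ ε)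
  have h1 := Set.ncard_le_ncard hsub hfin
  rw [Set.ncard_coe_finset, Finset.card_image_of_injective _ (bpt_injective P K), hScard] at h1
  have h1' : ((badIdx P₀ P ε).card : ℝ) * ((deepIdx K d₁).card : ℝ) ≤
      ((badSet P₀ (Qj P P₀ K M hε hK) ε).ncard : ℝ) := by exact_mod_cast h1
  rw [card_badIdx] at h1'
  have h2 := card_deepIdx_ge K d₁
  have hb : (0 : ℝ) ≤ (badSet P₀ P ε).ncard := Nat.cast_nonneg _
  calc ((badSet P₀ P ε).ncard : ℝ) * ((K : ℝ) ^ 3 - 6 * (d₁ : ℕ) * (K : ℝ) ^ 2)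
      ≤ ((badSet P₀ P ε).ncard : ℝ) * ((deepIdx K d₁).card : ℝ) :=
        mul_le_mul_of_nonneg_left h2 hb
    _ ≤ _ := h1'

/-- **Upper bound**: bad motif points of `Qj` are copies of points of `P` or NON-deep copies of
points of `P₀` (deep ones are good), so `#bad(Qj) ≤ #F·K³ + #F₀ · 6 d₀ M²`, `d₀ = depth_{P₀}(3 + ε)`. -/
theorem ncard_badSet_Qj_le (hε : 0 ≤ ε) (hK : 0 < K) :
    ((badSet P₀ (Qj P P₀ K M hε hK) ε).ncard : ℝ) ≤
      P.motif.card * (K : ℝ) ^ 3 + P₀.motif.card * (6 * (depth P₀ (3 + ε)) * (M : ℝ) ^ 2) := by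
  classical
  set d₀ := depth P₀ (3 + ε) with hd₀
  set ND : Finset (BIdx P₀ M) := Finset.univ.filter fun v : BIdx P₀ M => ¬ IsDeep M d₀ v.2 with hND
  set T : Finset E3 := (Finset.univ : Finset (BIdx P K)).image (bpt P K) ∪
    ND.image (fun v => bpt P₀ M v + shift P P₀ K M ε) with hT
  have hsub : badSet P₀ (Qj P P₀ K M hε hK) ε ⊆ (T : Set E3) := by
    rintro x ⟨hx, hbad⟩
    rw [motif_Qj] at hx
    obtain ⟨a, -, rfl⟩ := Finset.mem_image.1 hx
    rw [jux_apply] at hbad ⊢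
    generalize (Fintype.equivFin (JIdx P P₀ K M)).symm a = p at hbad ⊢
    rcases p with u | v
    · rw [Finset.mem_coe, hT]
      exact Finset.mem_union_left _ (Finset.mem_image_of_mem _ (Finset.mem_univ u))
    · rw [Finset.mem_coe, hT]
      refine Finset.mem_union_right _ (Finset.mem_image.2 ⟨v, ?_, rfl⟩)
      rw [hND, Finset.mem_filter]
      refine ⟨Finset.mem_univ v, fun hdeep => hbad ?_⟩
      rw [juxS_inr]
      exact goodIn_Qj_right P P₀ K M hε hK hdeep
  have h1 := Set.ncard_le_ncard hsub (Finset.finite_toSet T)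
  rw [Set.ncard_coe_finset] at h1
  have h2 : T.card ≤ Fintype.card (BIdx P K) + ND.card := by
    refine (Finset.card_union_le _ _).trans (add_le_add ?_ Finset.card_image_le)
    exact Finset.card_image_le.trans (by rw [Finset.card_univ])
  have h3 : ND.card = P₀.motif.card *
      (Finset.univ.filter fun k : Fin 3 → Fin M => ¬ IsDeep M d₀ k).card := by
    have : ND = (Finset.univ : Finset P₀.motif) ×ˢ
        (Finset.univ.filter fun k : Fin 3 → Fin M => ¬ IsDeep M d₀ k) := by
      rw [hND, ← Finset.filter_product_right, Finset.univ_product_univ]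
    rw [this, Finset.card_product, Finset.card_univ, Fintype.card_coe]
  have h4 := card_not_deep_le_real M d₀
  have h5 : ((badSet P₀ (Qj P P₀ K M hε hK) ε).ncard : ℝ) ≤
      (Fintype.card (BIdx P K) : ℝ) + (ND.card : ℝ) := by exact_mod_cast h1.trans h2
  rw [card_BIdx, h3] at h5
  push_cast at h5
  have hn₀ : (0 : ℝ) ≤ P₀.motif.card := Nat.cast_nonneg _
  nlinarith [h5, mul_le_mul_of_nonneg_left h4 hn₀]

end CountQj

/-! ## §4 The dilution lemma -/

section Arith

/-- Arithmetic of the bad fraction of the diluted competitor. -/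
theorem frac_arith {n n₀ θ₀ L K d₀ NQ : ℝ} (hn : 0 ≤ n) (hn₀ : 0 ≤ n₀) (hθ₀ : 0 ≤ θ₀)
    (_hL0 : 0 ≤ L) (_hK0 : 0 ≤ K)
    (hL : 2 * n ≤ θ₀ * n₀ * L ^ 3) (hKd₀ : 12 * d₀ ≤ θ₀ * L * K)
    (F6 : NQ ≤ n * K ^ 3 + n₀ * (6 * d₀ * (L * K) ^ 2)) :
    NQ ≤ θ₀ * (n * K ^ 3 + n₀ * (L * K) ^ 3) := by
  have hK3 : 0 ≤ K ^ 3 := by positivity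
  have h1 := mul_le_mul_of_nonneg_right hL hK3
  have hw : 0 ≤ n₀ * L ^ 2 * K ^ 2 := by positivity
  have h2 := mul_le_mul_of_nonneg_right hKd₀ hw
  have h3 : 0 ≤ θ₀ * (n * K ^ 3) := by positivity
  nlinarith [h1, h2, h3]

/-- Arithmetic of the final contradiction. -/
theorem contra_arith {n n₀ b eP e₀ g δ L K d₁ E₁ E₂ eQ NQ : ℝ}
    (hg : 0 ≤ g) (hK : 1 ≤ K)
    (hcon : n * (eP - e₀) < g * b)
    (hδ : δ * (4 * (n + n₀ * L ^ 3)) = g * b - n * (eP - e₀))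
    (F2 : (n * K ^ 3 + n₀ * (L * K) ^ 3) * eQ ≤ E₁ + E₂)
    (F3 : E₁ ≤ n * K ^ 3 * (eP + δ)) (F4 : E₂ ≤ n₀ * (L * K) ^ 3 * (e₀ + δ))
    (F5 : b * (K ^ 3 - 6 * d₁ * K ^ 2) ≤ NQ)
    (F7 : g * NQ ≤ (n * K ^ 3 + n₀ * (L * K) ^ 3) * (eQ - e₀))
    (F9 : 24 * g * b * d₁ ≤ (g * b - n * (eP - e₀)) * K) : False := by
  have hK2 : 0 ≤ K ^ 2 := by positivity
  have hK3 : 1 ≤ K ^ 3 := one_le_pow₀ hK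
  have hF5 := mul_le_mul_of_nonneg_left F5 hg
  have hF9 := mul_le_mul_of_nonneg_right F9 hK2
  have hδK : (n * K ^ 3 + n₀ * (L * K) ^ 3) * δ * 4 = K ^ 3 * (g * b - n * (eP - e₀)) := by
    rw [← hδ]; ring
  have hs : 0 < g * b - n * (eP - e₀) := by linarith
  have hsK : g * b - n * (eP - e₀) ≤ K ^ 3 * (g * b - n * (eP - e₀)) := by nlinarith
  nlinarith [hF5, hF9, hδK, F2, F3, F4, F7, hsK, hs]

end Arith

set_option maxHeartbeats 800000 in
/-- **DILUTION LEMMA.** The dilute-regime inequality implies the crux for ALL competitors, with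
the same constant: `DiluteTwoShellPricing → TwoShellDefectGap`. -/
theorem twoShellDefectGap_of_dilute (hD : DiluteTwoShellPricing) : TwoShellDefectGap := by
  intro P₀ hmin ε hε
  obtain ⟨θ₀, g, hθ₀, hg, hdil⟩ := hD P₀ hmin ε hε
  refine ⟨g, hg, fun P => ?_⟩
  change g * ((badSet P₀ P ε).ncard : ℝ) ≤
    (P.motif.card : ℝ) * (P.energyPerParticle lennardJones - P₀.energyPerParticle lennardJones)
  -- short names (opaque reals with defining equations)
  obtain ⟨n, hn⟩ : ∃ n : ℝ, n = P.motif.card := ⟨_, rfl⟩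
  obtain ⟨n₀, hn₀⟩ : ∃ n₀ : ℝ, n₀ = P₀.motif.card := ⟨_, rfl⟩
  obtain ⟨b, hb⟩ : ∃ b : ℝ, b = (badSet P₀ P ε).ncard := ⟨_, rfl⟩
  obtain ⟨eP, heP⟩ : ∃ eP : ℝ, eP = P.energyPerParticle lennardJones := ⟨_, rfl⟩
  obtain ⟨e₀, he₀⟩ : ∃ e₀ : ℝ, e₀ = P₀.energyPerParticle lennardJones := ⟨_, rfl⟩
  rw [← hn, ← hb, ← heP, ← he₀]
  have hn_pos : 0 < n := by rw [hn]; exact_mod_cast P.motif_nonempty.card_pos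
  have hn₀_pos : 0 < n₀ := by rw [hn₀]; exact_mod_cast P₀.motif_nonempty.card_pos
  have hb_nonneg : 0 ≤ b := by rw [hb]; exact Nat.cast_nonneg _
  have hmin' : e₀ ≤ eP := by rw [he₀, heP]; exact hmin.2 ⟨P, rfl⟩
  by_contra hcon
  push Not at hcon
  -- the slack
  obtain ⟨s, hs⟩ : ∃ s : ℝ, s = g * b - n * (eP - e₀) := ⟨_, rfl⟩
  have hs_pos : 0 < s := by rw [hs]; linarith
  -- the dilution ratio `L`
  obtain ⟨L, hL1, hL⟩ : ∃ L : ℕ, 1 ≤ L ∧ 2 * n ≤ θ₀ * n₀ * (L : ℝ) ^ 3 := by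
    obtain ⟨L₀, hL₀⟩ := exists_nat_ge (2 * n / (θ₀ * n₀))
    refine ⟨L₀ + 1, by omega, ?_⟩
    have hpos : 0 < θ₀ * n₀ := mul_pos hθ₀ hn₀_pos
    have hx : 2 * n ≤ θ₀ * n₀ * L₀ := by rw [div_le_iff₀ hpos] at hL₀; linarith
    have hcube : (L₀ : ℝ) ≤ ((L₀ + 1 : ℕ) : ℝ) ^ 3 := by
      push_cast
      have h1 : (1 : ℝ) ≤ L₀ + 1 := by linarith [Nat.cast_nonneg (α := ℝ) L₀]
      exact (le_add_of_nonneg_right zero_le_one).trans (le_self_pow₀ h1 (by norm_num))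
    exact hx.trans (mul_le_mul_of_nonneg_left hcube hpos.le)
  have hLpos : (0 : ℝ) < L := by exact_mod_cast hL1
  -- the energy tolerance `δ`
  have hden : 0 < n + n₀ * (L : ℝ) ^ 3 := by positivity
  obtain ⟨δ, hδ⟩ : ∃ δ : ℝ, δ = s / (4 * (n + n₀ * (L : ℝ) ^ 3)) := ⟨_, rfl⟩
  have hδ_pos : 0 < δ := by rw [hδ]; positivity
  have hδ' : δ * (4 * (n + n₀ * (L : ℝ) ^ 3)) = g * b - n * (eP - e₀) := by
    rw [hδ, ← hs]; field_simp
  obtain ⟨K₁, -, hK₁⟩ := exists_block_energy_le P hδ_pos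
  obtain ⟨K₂, -, hK₂⟩ := exists_block_energy_le P₀ hδ_pos
  obtain ⟨d₁, hd₁⟩ : ∃ d₁ : ℕ, d₁ = depth P (3 + ε) := ⟨_, rfl⟩
  obtain ⟨d₀, hd₀⟩ : ∃ d₀ : ℕ, d₀ = depth P₀ (3 + ε) := ⟨_, rfl⟩
  -- the block size `K`
  obtain ⟨X, hX⟩ : ∃ X : ℝ, X = K₁ + K₂ + 1 + 12 * d₀ / (θ₀ * L) + 24 * g * b * d₁ / s := ⟨_, rfl⟩
  obtain ⟨K, hKX⟩ := exists_nat_ge X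
  have hA : (0 : ℝ) ≤ 12 * d₀ / (θ₀ * L) := by positivity
  have hB : (0 : ℝ) ≤ 24 * g * b * d₁ / s := by positivity
  have hK₁r : (0 : ℝ) ≤ K₁ := Nat.cast_nonneg _
  have hK₂r : (0 : ℝ) ≤ K₂ := Nat.cast_nonneg _
  have hKK₁ : K₁ ≤ K := by exact_mod_cast (show (K₁ : ℝ) ≤ K by linarith)
  have hKK₂ : K₂ ≤ K := by exact_mod_cast (show (K₂ : ℝ) ≤ K by linarith)
  have hK1 : 1 ≤ K := by exact_mod_cast (show ((1 : ℕ) : ℝ) ≤ K by push_cast; linarith)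
  have hK : 0 < K := hK1
  have hKr : (1 : ℝ) ≤ K := by exact_mod_cast hK1
  have hKd₀ : 12 * (d₀ : ℝ) ≤ θ₀ * L * K := by
    have hpos : 0 < θ₀ * L := mul_pos hθ₀ hLpos
    have h1 : 12 * (d₀ : ℝ) ≤ X * (θ₀ * L) := by rw [← div_le_iff₀ hpos]; linarith
    calc 12 * (d₀ : ℝ) ≤ X * (θ₀ * L) := h1
      _ ≤ K * (θ₀ * L) := mul_le_mul_of_nonneg_right hKX hpos.le
      _ = θ₀ * L * K := by ring
  have hKd₁ : 24 * g * b * (d₁ : ℝ) ≤ (g * b - n * (eP - e₀)) * K := by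
    have h1 : 24 * g * b * (d₁ : ℝ) ≤ X * s := by rw [← div_le_iff₀ hs_pos]; linarith
    calc 24 * g * b * (d₁ : ℝ) ≤ X * s := h1
      _ ≤ K * s := mul_le_mul_of_nonneg_right hKX hs_pos.le
      _ = (g * b - n * (eP - e₀)) * K := by rw [hs]; ring
  -- the diluted competitor `Qj P P₀ K M`, `M = L K`
  obtain ⟨M, hM⟩ : ∃ M : ℕ, M = L * K := ⟨_, rfl⟩
  have hMr : (M : ℝ) = L * K := by rw [hM]; push_cast; ring
  have hKM₂ : K₂ ≤ M := hKK₂.trans (by rw [hM]; exact Nat.le_mul_of_pos_left K hL1)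
  -- (a) energies
  have F3 : interactionEnergy lennardJones (blockConfig P K) ≤ n * (K : ℝ) ^ 3 * (eP + δ) := by
    have h := hK₁ K hKK₁
    have hc : ((Fintype.card (BIdx P K) : ℕ) : ℝ) = n * (K : ℝ) ^ 3 := by
      rw [card_BIdx]; push_cast; rw [hn]
    rw [hc, ← heP] at h
    exact h
  have F4 : interactionEnergy lennardJones (blockConfig P₀ M) ≤
      n₀ * ((L : ℝ) * K) ^ 3 * (e₀ + δ) := by
    have h := hK₂ M hKM₂
    have hc : ((Fintype.card (BIdx P₀ M) : ℕ) : ℝ) = n₀ * ((L : ℝ) * K) ^ 3 := by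
      rw [card_BIdx]; push_cast; rw [hn₀, hMr]
    rw [hc, ← he₀] at h
    exact h
  have F2 : (n * (K : ℝ) ^ 3 + n₀ * ((L : ℝ) * K) ^ 3) *
      (Qj P P₀ K M hε.le hK).energyPerParticle lennardJones ≤
      interactionEnergy lennardJones (blockConfig P K) +
        interactionEnergy lennardJones (blockConfig P₀ M) := by
    have h := energyPerParticle_Qj_le P P₀ K M hε.le hK
    push_cast at h
    rw [← hn, ← hn₀, hMr] at h
    exact h
  have hcardQ : (((Qj P P₀ K M hε.le hK).motif.card : ℕ) : ℝ) =
      n * (K : ℝ) ^ 3 + n₀ * ((L : ℝ) * K) ^ 3 := by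
    rw [card_motif_Qj]; push_cast; rw [← hn, ← hn₀, hMr]
  -- (b) bad counts
  have F5 : b * ((K : ℝ) ^ 3 - 6 * (d₁ : ℝ) * (K : ℝ) ^ 2) ≤
      ((badSet P₀ (Qj P P₀ K M hε.le hK) ε).ncard : ℝ) := by
    have h := ncard_badSet_Qj_ge P P₀ K M hε.le hK
    rw [← hb, ← hd₁] at h
    exact h
  have F6 : ((badSet P₀ (Qj P P₀ K M hε.le hK) ε).ncard : ℝ) ≤
      n * (K : ℝ) ^ 3 + n₀ * (6 * (d₀ : ℝ) * ((L : ℝ) * K) ^ 2) := by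
    have h := ncard_badSet_Qj_le P P₀ K M hε.le hK
    rw [← hn, ← hn₀, ← hd₀, hMr] at h
    exact h
  -- (c) the dilute hypothesis applies to the diluted competitor
  have hfrac : ((badSet P₀ (Qj P P₀ K M hε.le hK) ε).ncard : ℝ) ≤
      θ₀ * (Qj P P₀ K M hε.le hK).motif.card := by
    rw [hcardQ]
    exact frac_arith hn_pos.le hn₀_pos.le hθ₀.le hLpos.le (by linarith) hL hKd₀ F6
  have F7 := hdil (Qj P P₀ K M hε.le hK) hfrac
  rw [hcardQ, ← he₀] at F7
  -- (d) contradiction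
  exact contra_arith hg.le hKr hcon hδ' F2 F3 F4 F5 F7 hKd₁


/-- The converse is trivial (`θ₀ = 1`, same `g`). -/
theorem dilute_of_twoShellDefectGap (h : TwoShellDefectGap) : DiluteTwoShellPricing := by
  intro P₀ hmin η hη
  obtain ⟨g, hg, hP⟩ := h P₀ hmin η hη
  exact ⟨1, g, one_pos, hg, fun P _ => hP P⟩

/-- **The dilute regime IS the crux**: `DiluteTwoShellPricing ↔ TwoShellDefectGap`. -/
theorem dilute_iff : DiluteTwoShellPricing ↔ TwoShellDefectGap :=
  ⟨twoShellDefectGap_of_dilute, dilute_of_twoShellDefectGap⟩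

end Summit.AtomisticToContinuum.Crystallization.Cruxes.TwoShellDefectGap.Dilution

end
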